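import Summits.Parity.GeneralizedHardyLittlewood.Theorems.ConstellationCubesFibreTranslation
import Summits.Parity.GeneralizedHardyLittlewood.Theses.TwinMinorArcs
import HarnessLib

/-!
# The translation-class slice of the shift lift `BoundedDickson → DimOne`
(crux `TwinLowerDensityToGHL`, stmt-Parity-18380, line `birth_ParityLeakOneFifth`, stub `stub_shiftLift`)

The registered stub `stub_shiftLift` of `Cruxes/TwinLowerDensityToGHL/Lines/birth_ParityLeakOneFifth.lean` is the
SHIFT LIFT: Dickson–Hardy–Littlewood for every FIXED non-degenerate one-dimensional system
(`BoundedDickson`, stmt-Parity-13151 — verbatim the stub's hypothesis) implies the SHIFT-UNIFORM statement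
`GeneralizedHardyLittlewoodDimOne` (stmt-Parity-0819: one `N₀(t, L, ε)` for all `Ψ` with `‖Ψ‖_N ≤ L`, i.e. slopes
`|aᵢ| ≤ L` and constants `|bᵢ| ≤ L·N`).  It is GHL-hard as a whole (Landau–Siegel-complete:
`Theorems.PairsToGHL.Negative.not_generalizedHardyLittlewoodDimOne_of_unboundedSiegelZeros`).

This file proves the part of it that DOES follow from the hypothesis, and thereby locates the open content exactly:

* `isNondegenerateSystem_of_transl` — non-degeneracy passes from a translate `ψ'ᵢ(n) = ψᵢ(n + c)` back to `Ψ`.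
* `uniform_translationClass` — **`BoundedDickson` ⇒ Hardy–Littlewood UNIFORMLY over the translation class of
  width `B`**: one `N₀(t, L, B, ε)` serves every non-degenerate `Ψ : Fin t → AffLinForm 1` with `‖Ψ‖_N ≤ L` whose
  constant vector lies within `B` of an exact translate, `∃ c ∈ ℤ, ∀ i, |bᵢ − aᵢ c| ≤ B` (so `|c|` may be as large
  as `L·N + B`), and every convex `K ⊆ [−N, N]`.  Proof: `Ψ` is the translate by `c` of the base system
  `(aᵢ n + rᵢ)ᵢ`, `rᵢ = bᵢ − aᵢ c`, whose parameters range over the FINITE box `[−L, L]^t × [−B, B]^t`; translation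
  moves prime sums, archimedean factors and singular products exactly (`ConstellationCubesFibreTranslation`), at the
  cost of reading the translated body at scale `N₁ = (L+1)N + B`; so `BoundedDickson` for the finitely many base
  systems with `ε' = ε/(L+B+2)` and `N₀ = max over the box` suffices.
* `uniform_boundedDiameter_unitSlope` — the reading for prime `t`-tuples: patterns `(n + b₁, …, n + b_t)` of
  diameter `≤ B` placed ANYWHERE up to height `L·N` (all `|bᵢ| ≤ L·N`) are asymptotically counted, uniformly, by
  `BoundedDickson`.

RESIDUAL (what `stub_shiftLift` still asks beyond this file, stated for the record; not proved here): uniformity over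
systems whose constants are NOT within bounded distance of a translate — equivalently with some pair discriminant
`|aᵢ bⱼ − aⱼ bᵢ|` unbounded as `N → ∞` (pairs `(n, n + h)` with `h → ∞`, `h ≤ L·N`; Goldbach `(n, M − n)`).  That is
exactly the binary, Siegel-sensitive content of stmt-Parity-0819.  No new definitions.
[cite: GreenTao2010, Conj. 1.2 and §1 (remark after Conj. 1.2), (1.1), (1.4), (1.6)] [cite: Dickson1904]
-/

open Finset MeasureTheory

namespace Summit.Parity.GeneralizedHardyLittlewood.TwinLowerDensityToGHLShiftLiftTranslationClass

open Literature.NumberTheory.Sieve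
open Summit.Parity.GeneralizedHardyLittlewood.ConstellationCubesFibreTranslation
open Summit.Parity.GeneralizedHardyLittlewood.Theses.TwinMinorArcs (BoundedDickson)

variable {t : ℕ}

/-- **Non-degeneracy of the base of a translate.** If `Φ'` is the translate `φ'ᵢ(n) = φᵢ(n + c)` of `Φ` (same
coefficients, constants `bᵢ + aᵢ c`) and `Φ'` is non-degenerate, so is `Φ` (the linear parts agree, and a rational
proportionality `a φᵢ = b φⱼ` on `ℤ` transports to `Φ'` by the substitution `n ↦ n + c`).
[cite: GreenTao2010, Def. 1.1] -/
theorem isNondegenerateSystem_of_transl {Φ Φ' : Fin t → AffLinForm 1} {c : ℤ}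
    (htr : ∀ i, (Φ' i).coeff = (Φ i).coeff ∧ (Φ' i).const = (Φ i).const + (Φ i).coeff 0 * c)
    (h : IsNondegenerateSystem Φ') : IsNondegenerateSystem Φ := by
  refine ⟨fun i => ?_, fun i j hij a b hab => ?_⟩
  · rw [← (htr i).1]
    exact h.1 i
  · refine h.2 i j hij a b fun n => ?_
    rw [eval_transl htr i n, eval_transl htr j n]
    exact hab _

/-- `‖Ψ‖_N ≤ L` bounds every slope: `|aᵢ| ≤ L` (as an integer inequality). [cite: GreenTao2010, (1.1)] -/
theorem abs_coeff_le_of_affLinSize_le {Ψ : Fin t → AffLinForm 1} {N : ℝ} {L : ℕ}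
    (hL : affLinSize Ψ N ≤ L) (i : Fin t) : |(Ψ i).coeff 0| ≤ (L : ℤ) := by
  have h1 : |((Ψ i).coeff 0 : ℝ)| ≤ ∑ j, |((Ψ i).coeff j : ℝ)| :=
    Finset.single_le_sum (f := fun j => |((Ψ i).coeff j : ℝ)|) (fun _ _ => abs_nonneg _) (Finset.mem_univ 0)
  have h2 : ∑ j, |((Ψ i).coeff j : ℝ)| ≤ ∑ i', ∑ j, |((Ψ i').coeff j : ℝ)| :=
    Finset.single_le_sum (f := fun i' => ∑ j, |((Ψ i').coeff j : ℝ)|)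
      (fun _ _ => Finset.sum_nonneg fun _ _ => abs_nonneg _) (Finset.mem_univ i)
  have h3 : 0 ≤ ∑ i', |((Ψ i').const : ℝ) / N| := Finset.sum_nonneg fun _ _ => abs_nonneg _
  have h4 : |((Ψ i).coeff 0 : ℝ)| ≤ L := by
    unfold affLinSize at hL
    linarith
  have h5 : ((|(Ψ i).coeff 0| : ℤ) : ℝ) ≤ ((L : ℤ) : ℝ) := by push_cast; exact h4
  exact_mod_cast h5

/-- `‖Ψ‖_N ≤ L` bounds every constant: `|bᵢ| ≤ L N` (`N ≥ 1`, as an integer inequality).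
[cite: GreenTao2010, (1.1)] -/
theorem abs_const_le_of_affLinSize_le {Ψ : Fin t → AffLinForm 1} {N L : ℕ} (hN : 1 ≤ N)
    (hL : affLinSize Ψ N ≤ L) (i : Fin t) : |(Ψ i).const| ≤ (L : ℤ) * N := by
  have hN0 : (0 : ℝ) < N := by exact_mod_cast hN
  have h1 : |((Ψ i).const : ℝ) / N| ≤ ∑ i', |((Ψ i').const : ℝ) / N| :=
    Finset.single_le_sum (f := fun i' => |((Ψ i').const : ℝ) / N|) (fun _ _ => abs_nonneg _) (Finset.mem_univ i)
  have h2 : ∑ i', |((Ψ i').const : ℝ) / N| ≤ affLinSize Ψ N :=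
    le_add_of_nonneg_left (Finset.sum_nonneg fun _ _ => Finset.sum_nonneg fun _ _ => abs_nonneg _)
  have h3 : |((Ψ i).const : ℝ)| ≤ L * N := by
    have := h1.trans (h2.trans hL)
    rwa [abs_div, abs_of_pos hN0, div_le_iff₀ hN0] at this
  have h4 : ((|(Ψ i).const| : ℤ) : ℝ) ≤ (((L : ℤ) * N : ℤ) : ℝ) := by push_cast; exact h3
  exact_mod_cast h4

/-- **`BoundedDickson` ⇒ Hardy–Littlewood uniformly over a translation class.**  Assume Dickson–Hardy–Littlewood
for every fixed non-degenerate one-dimensional system (`BoundedDickson`, stmt-Parity-13151 = the hypothesis of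
`stub_shiftLift`).  Then for all `t ≥ 1`, `L`, `B` and `ε > 0` there is ONE `N₀` such that for all `N ≥ N₀`, every
non-degenerate `Ψ : Fin t → AffLinForm 1` with `‖Ψ‖_N ≤ L` whose constants lie within `B` of an exact translate —
`∃ c, ∀ i, |bᵢ − aᵢ c| ≤ B` (the translation parameter `c` is free, `|c| ≤ L N + B`) — and every convex
`K ⊆ [−N, N]` satisfy `|∑_{K ∩ ℤ} ∏ᵢ Λ(ψᵢ(n)) − β_∞ ∏_p β_p| ≤ ε N`.
This is the translation-class slice of the conclusion of `stub_shiftLift` (`GeneralizedHardyLittlewoodDimOne`); the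
residual of the stub is the complement (constants not within bounded distance of a translate).
[cite: GreenTao2010, Conj. 1.2 and §1 (remark after Conj. 1.2)] -/
theorem uniform_translationClass (hBD : BoundedDickson) (t L B : ℕ) (ht : 1 ≤ t) (ε : ℝ) (hε : 0 < ε) :
    ∃ N₀ : ℕ, ∀ N : ℕ, N₀ ≤ N → ∀ Ψ : Fin t → AffLinForm 1, IsNondegenerateSystem Ψ →
      affLinSize Ψ N ≤ L → (∃ c : ℤ, ∀ i, |(Ψ i).const - (Ψ i).coeff 0 * c| ≤ B) →
      ∀ K : Set (Fin 1 → ℝ), Convex ℝ K → K ⊆ realBox 1 N →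
        |vonMangoldtSum Ψ K N - archFactor Ψ K * singularProduct Ψ| ≤ ε * (N : ℝ) := by
  classical
  -- the finite parameter box: slopes in `[-L, L]^t`, reduced constants in `[-B, B]^t`
  set P : Finset ((Fin t → ℤ) × (Fin t → ℤ)) :=
    (Fintype.piFinset fun _ : Fin t => Icc (-(L : ℤ)) L) ×ˢ
      (Fintype.piFinset fun _ : Fin t => Icc (-(B : ℤ)) B) with hP
  -- the base system of a parameter: `φᵢ(n) = aᵢ n + rᵢ`
  set base : (Fin t → ℤ) × (Fin t → ℤ) → (Fin t → AffLinForm 1) :=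
    fun p i => ⟨fun _ => p.1 i, p.2 i⟩ with hbase
  set ε' : ℝ := ε / (L + B + 2) with hε'
  have hε'pos : 0 < ε' := by rw [hε']; positivity
  -- a `BoundedDickson` threshold for each parameter (vacuous for degenerate base systems)
  have hthr : ∀ p : (Fin t → ℤ) × (Fin t → ℤ), ∃ n₀ : ℕ, IsNondegenerateSystem (base p) →
      ∀ N : ℕ, n₀ ≤ N → ∀ K : Set (Fin 1 → ℝ), Convex ℝ K → K ⊆ realBox 1 N →
        |vonMangoldtSum (base p) K N - archFactor (base p) K * singularProduct (base p)| ≤ ε' * N := by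
    intro p
    by_cases hp : IsNondegenerateSystem (base p)
    · obtain ⟨n₀, hn₀⟩ := hBD t (base p) ht hp ε' hε'pos
      exact ⟨n₀, fun _ => hn₀⟩
    · exact ⟨0, fun h => absurd h hp⟩
  choose thr hthr using hthr
  refine ⟨max 1 (P.sup thr), fun N hN Ψ hΨ hL hc K hK hKN => ?_⟩
  obtain ⟨c, hc⟩ := hc
  have hN1 : 1 ≤ N := le_of_max_le_left hN
  have hNsup : P.sup thr ≤ N := le_of_max_le_right hN
  -- the parameters of `Ψ`
  set a : Fin t → ℤ := fun i => (Ψ i).coeff 0 with ha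
  set r : Fin t → ℤ := fun i => (Ψ i).const - (Ψ i).coeff 0 * c with hr
  have hmem : (a, r) ∈ P := by
    rw [hP, Finset.mem_product]
    refine ⟨Fintype.mem_piFinset.mpr fun i => ?_, Fintype.mem_piFinset.mpr fun i => ?_⟩
    · have h := abs_coeff_le_of_affLinSize_le hL i
      rw [abs_le] at h
      exact Finset.mem_Icc.mpr ⟨h.1, h.2⟩
    · have h := hc i
      rw [abs_le] at h
      exact Finset.mem_Icc.mpr ⟨h.1, h.2⟩
  have hthrN : thr (a, r) ≤ N := (Finset.le_sup (f := thr) hmem).trans hNsup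
  -- `Ψ` is the translate of `base (a, r)` by `c`
  have htr : ∀ i, (Ψ i).coeff = (base (a, r) i).coeff ∧
      (Ψ i).const = (base (a, r) i).const + (base (a, r) i).coeff 0 * c := by
    intro i
    refine ⟨?_, ?_⟩
    · funext k
      rw [Fin.fin_one_eq_zero k]
    · show (Ψ i).const = ((Ψ i).const - (Ψ i).coeff 0 * c) + (Ψ i).coeff 0 * c
      ring
  have hnd : IsNondegenerateSystem (base (a, r)) := isNondegenerateSystem_of_transl htr hΨ
  -- the translation parameter is at most `L N + B`: use the form `i₀ = 0`, whose slope is non-zero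
  set i₀ : Fin t := ⟨0, ht⟩ with hi₀
  have ha0 : (Ψ i₀).coeff 0 ≠ 0 := by
    intro h0
    apply hΨ.1 i₀
    funext k
    rw [Fin.fin_one_eq_zero k, h0]
    rfl
  have hcB : |c| ≤ (L : ℤ) * N + B := by
    have h1 : (1 : ℤ) ≤ |(Ψ i₀).coeff 0| := Int.one_le_abs ha0
    have h2 : |(Ψ i₀).coeff 0 * c| ≤ (L : ℤ) * N + B := by
      have e : (Ψ i₀).coeff 0 * c = (Ψ i₀).const - ((Ψ i₀).const - (Ψ i₀).coeff 0 * c) := by ring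
      rw [e]
      exact (abs_sub _ _).trans (add_le_add (abs_const_le_of_affLinSize_le hN1 hL i₀) (hc i₀))
    rw [abs_mul] at h2
    nlinarith [abs_nonneg c]
  -- the scale at which the translated body is read
  set N₁ : ℕ := (L + 1) * N + B with hN₁
  have hNN₁ : (N : ℤ) + |c| ≤ N₁ := by rw [hN₁]; push_cast; nlinarith
  have hthrN₁ : thr (a, r) ≤ N₁ := hthrN.trans (by rw [hN₁]; nlinarith)
  have key := hthr (a, r) hnd N₁ hthrN₁ _ (convex_transl hK _) (transl_subset_realBox hKN hNN₁)
  rw [vonMangoldtSum_transl htr hKN hNN₁, archFactor_transl htr, singularProduct_transl htr]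
  refine key.trans ?_
  -- `ε' N₁ ≤ ε N`
  have hN1r : (1 : ℝ) ≤ N := by exact_mod_cast hN1
  have hbound : ((L : ℝ) + 1) * N + B ≤ ((L : ℝ) + B + 2) * N := by nlinarith
  have hLB : (0 : ℝ) < (L : ℝ) + B + 2 := by positivity
  rw [hε', hN₁]
  push_cast
  rw [div_mul_eq_mul_div, div_le_iff₀ hLB]
  nlinarith [hε.le]

/-- **Prime `t`-tuples of bounded diameter at every height up to `L N`, uniformly.**  Assume `BoundedDickson`.
For all `t ≥ 1`, `L`, `B`, `ε > 0` there is `N₀` such that for all `N ≥ N₀`, every non-degenerate unit-slope system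
`ψᵢ(n) = n + bᵢ` with `‖Ψ‖_N ≤ L` (so `|bᵢ| ≤ L N`) and diameter `|bᵢ − bⱼ| ≤ B`, and every convex `K ⊆ [−N, N]`:
`|∑_{n ∈ K} ∏ᵢ Λ(n + bᵢ) − β_∞ 𝔖| ≤ ε N` — e.g. the twin count `∑_{M ≤ n ≤ M + N} Λ(n)Λ(n + 2)` uniformly in
`M ≤ L N`.  (Translation class of width `B` with `c = b_{i₀}`.) [cite: GreenTao2010, Conj. 1.2; Dickson1904] -/
theorem uniform_boundedDiameter_unitSlope (hBD : BoundedDickson) (t L B : ℕ) (ht : 1 ≤ t) (ε : ℝ)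
    (hε : 0 < ε) :
    ∃ N₀ : ℕ, ∀ N : ℕ, N₀ ≤ N → ∀ Ψ : Fin t → AffLinForm 1, IsNondegenerateSystem Ψ →
      affLinSize Ψ N ≤ L → (∀ i, (Ψ i).coeff 0 = 1) → (∀ i j, |(Ψ i).const - (Ψ j).const| ≤ B) →
      ∀ K : Set (Fin 1 → ℝ), Convex ℝ K → K ⊆ realBox 1 N →
        |vonMangoldtSum Ψ K N - archFactor Ψ K * singularProduct Ψ| ≤ ε * (N : ℝ) := by
  obtain ⟨N₀, hN₀⟩ := uniform_translationClass hBD t L B ht ε hε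
  refine ⟨N₀, fun N hN Ψ hΨ hL h1 hdiam K hK hKN => hN₀ N hN Ψ hΨ hL ⟨(Ψ ⟨0, ht⟩).const, fun i => ?_⟩ K hK hKN⟩
  rw [h1 i, one_mul]
  exact hdiam i ⟨0, ht⟩


/-! ### Intrinsic form: bounded pair discriminants -/

/-- **Bounded discriminants ⇒ a translate within bounded distance.**  If a non-degenerate `Ψ` (`t ≥ 1`) with
`‖Ψ‖_N ≤ L` has all pair discriminants `|aᵢ bⱼ − aⱼ bᵢ| ≤ D`, then its constants lie within `D + L²` of an exact
translate: with `c = ⌊b₀ / a₀⌋` (Euclidean division by the non-zero slope of the form `i₀ = 0`, remainder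
`0 ≤ r₀ < |a₀| ≤ L`) one has `a₀ (bᵢ − aᵢ c) = (a₀ bᵢ − aᵢ b₀) + aᵢ r₀`, so `|bᵢ − aᵢ c| ≤ D + L·L`.
(The converse direction `|aᵢ bⱼ − aⱼ bᵢ| ≤ 2 L B` is immediate; the two descriptions of the translation class agree
up to constants.) [cite: GreenTao2010, Def. 1.1, (1.1)] -/
theorem exists_translate_of_disc_le {Ψ : Fin t → AffLinForm 1} (hΨ : IsNondegenerateSystem Ψ) (ht : 1 ≤ t)
    {N : ℝ} {L D : ℕ} (hL : affLinSize Ψ N ≤ L)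
    (hdisc : ∀ i j, |(Ψ i).coeff 0 * (Ψ j).const - (Ψ j).coeff 0 * (Ψ i).const| ≤ D) :
    ∃ c : ℤ, ∀ i, |(Ψ i).const - (Ψ i).coeff 0 * c| ≤ ((D + L * L : ℕ) : ℤ) := by
  set i₀ : Fin t := ⟨0, ht⟩ with hi₀
  have ha0 : (Ψ i₀).coeff 0 ≠ 0 := by
    intro h0
    apply hΨ.1 i₀
    funext k
    rw [Fin.fin_one_eq_zero k, h0]
    rfl
  refine ⟨(Ψ i₀).const / (Ψ i₀).coeff 0, fun i => ?_⟩
  -- the remainder of the Euclidean division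
  set r₀ : ℤ := (Ψ i₀).const - (Ψ i₀).coeff 0 * ((Ψ i₀).const / (Ψ i₀).coeff 0) with hr₀
  have hr₀mod : r₀ = (Ψ i₀).const % (Ψ i₀).coeff 0 := by
    rw [hr₀, Int.emod_def]
  have hr₀abs : |r₀| ≤ (L : ℤ) := by
    rw [hr₀mod, abs_of_nonneg (Int.emod_nonneg _ ha0)]
    exact ((Int.emod_lt_abs _ ha0).le).trans (abs_coeff_le_of_affLinSize_le hL i₀)
  have hid : (Ψ i₀).coeff 0 * ((Ψ i).const - (Ψ i).coeff 0 * ((Ψ i₀).const / (Ψ i₀).coeff 0)) =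
      ((Ψ i₀).coeff 0 * (Ψ i).const - (Ψ i).coeff 0 * (Ψ i₀).const) + (Ψ i).coeff 0 * r₀ := by
    rw [hr₀]
    ring
  have h1 : |(Ψ i₀).coeff 0| * |(Ψ i).const - (Ψ i).coeff 0 * ((Ψ i₀).const / (Ψ i₀).coeff 0)| ≤
      (D : ℤ) + L * L := by
    rw [← abs_mul, hid]
    refine (abs_add_le _ _).trans (add_le_add (hdisc i₀ i) ?_)
    rw [abs_mul]
    exact mul_le_mul (abs_coeff_le_of_affLinSize_le hL i) hr₀abs (abs_nonneg _) (by positivity)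
  have h2 : (1 : ℤ) ≤ |(Ψ i₀).coeff 0| := Int.one_le_abs ha0
  push_cast
  nlinarith [abs_nonneg ((Ψ i).const - (Ψ i).coeff 0 * ((Ψ i₀).const / (Ψ i₀).coeff 0))]

/-- **`BoundedDickson` ⇒ Hardy–Littlewood uniformly over bounded pair discriminants** (the intrinsic,
translation-invariant form of `uniform_translationClass`): one `N₀(t, L, D, ε)` serves every non-degenerate `Ψ`
with `‖Ψ‖_N ≤ L` and `|aᵢ bⱼ − aⱼ bᵢ| ≤ D` for all `i, j`, and every convex `K ⊆ [−N, N]`.  Equivalently: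
Dickson–Hardy–Littlewood for bounded PATTERNS at arbitrary position up to height `L N` follows from the
fixed-system statement.  The residual of `stub_shiftLift` is the large-discriminant regime
(`Theorems/TwinLowerDensityToGHLShiftLiftOffClassExactness.lean`). [cite: GreenTao2010, Conj. 1.2 (d = 1)] -/
theorem uniform_boundedDisc (hBD : BoundedDickson) (t L D : ℕ) (ht : 1 ≤ t) (ε : ℝ) (hε : 0 < ε) :
    ∃ N₀ : ℕ, ∀ N : ℕ, N₀ ≤ N → ∀ Ψ : Fin t → AffLinForm 1, IsNondegenerateSystem Ψ →
      affLinSize Ψ N ≤ L → (∀ i j, |(Ψ i).coeff 0 * (Ψ j).const - (Ψ j).coeff 0 * (Ψ i).const| ≤ D) →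
      ∀ K : Set (Fin 1 → ℝ), Convex ℝ K → K ⊆ realBox 1 N →
        |vonMangoldtSum Ψ K N - archFactor Ψ K * singularProduct Ψ| ≤ ε * (N : ℝ) := by
  obtain ⟨N₀, hN₀⟩ := uniform_translationClass hBD t L (D + L * L) ht ε hε
  exact ⟨N₀, fun N hN Ψ hΨ hL hdisc K hK hKN =>
    hN₀ N hN Ψ hΨ hL (exists_translate_of_disc_le hΨ ht hL hdisc) K hK hKN⟩


/-! ### Patterns spreading at SOME rate: the ineffective reach of the fixed-system hypothesis -/

/-- **`BoundedDickson` ⇒ Hardy–Littlewood uniformly over discriminants `≤ ω(N)` for some `ω(N) → ∞`.**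
The maximal (ineffective) reach of the fixed-system statement: for all `t ≥ 1`, `L`, `ε > 0` there are a rate
`ω : ℕ → ℕ` with `ω(N) → ∞` and an `N₀` such that the Hardy–Littlewood error is `≤ ε N` for all `N ≥ N₀`, every
non-degenerate `Ψ` with `‖Ψ‖_N ≤ L` and all pair discriminants `|aᵢ bⱼ − aⱼ bᵢ| ≤ ω(N)`, and every convex
`K ⊆ [−N, N]` (diagonalisation over `uniform_boundedDisc`: `ω(N) = max {B ≤ N : N₀(B') ≤ N for all B' ≤ B}`).
E.g. `∑_{n ≤ N} Λ(n)Λ(n + h) = 𝔖(h) N + o(N)` uniformly in `h ≤ ω(N)` from the fixed-`h` asymptotics — with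
NO control of the rate `ω`; the open content of `stub_shiftLift` is every QUANTIFIED rate up to `h ≤ L N`.
[cite: GreenTao2010, Conj. 1.2 (d = 1)] -/
theorem uniform_growingDisc (hBD : BoundedDickson) (t L : ℕ) (ht : 1 ≤ t) (ε : ℝ) (hε : 0 < ε) :
    ∃ ω : ℕ → ℕ, Filter.Tendsto ω Filter.atTop Filter.atTop ∧ ∃ N₀ : ℕ, ∀ N : ℕ, N₀ ≤ N →
      ∀ Ψ : Fin t → AffLinForm 1, IsNondegenerateSystem Ψ → affLinSize Ψ N ≤ L →
        (∀ i j, |(Ψ i).coeff 0 * (Ψ j).const - (Ψ j).coeff 0 * (Ψ i).const| ≤ ω N) →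
        ∀ K : Set (Fin 1 → ℝ), Convex ℝ K → K ⊆ realBox 1 N →
          |vonMangoldtSum Ψ K N - archFactor Ψ K * singularProduct Ψ| ≤ ε * (N : ℝ) := by
  classical
  -- thresholds `f B` for each discriminant bound `B`, and their monotone majorant `g`
  have hf : ∀ B : ℕ, ∃ n₀ : ℕ, ∀ N : ℕ, n₀ ≤ N → ∀ Ψ : Fin t → AffLinForm 1, IsNondegenerateSystem Ψ →
      affLinSize Ψ N ≤ L → (∀ i j, |(Ψ i).coeff 0 * (Ψ j).const - (Ψ j).coeff 0 * (Ψ i).const| ≤ B) →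
      ∀ K : Set (Fin 1 → ℝ), Convex ℝ K → K ⊆ realBox 1 N →
        |vonMangoldtSum Ψ K N - archFactor Ψ K * singularProduct Ψ| ≤ ε * (N : ℝ) :=
    fun B => uniform_boundedDisc hBD t L B ht ε hε
  choose f hf using hf
  set g : ℕ → ℕ := fun B => (range (B + 1)).sup f with hg
  have hfg : ∀ B, f B ≤ g B := fun B => Finset.le_sup (f := f) (Finset.mem_range.mpr (Nat.lt_succ_self B))
  -- the rate: the largest `B ≤ N` whose majorant threshold is already `≤ N`
  set ω : ℕ → ℕ := fun N => Nat.findGreatest (fun B => g B ≤ N) N with hω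
  refine ⟨ω, ?_, g 0, fun N hN Ψ hΨ hL hdisc K hK hKN => ?_⟩
  · -- `ω → ∞`: for `N ≥ max B₀ (g B₀)` the candidate `B₀` is admissible
    refine Filter.tendsto_atTop_atTop.mpr fun B₀ => ⟨max B₀ (g B₀), fun N hN => ?_⟩
    exact Nat.le_findGreatest (le_of_max_le_left hN) (le_of_max_le_right hN)
  · -- at `N ≥ g 0` the predicate holds at `ω N`, so the threshold `f (ω N) ≤ N` is met
    have hP : g (ω N) ≤ N := Nat.findGreatest_spec (P := fun B => g B ≤ N) (Nat.zero_le N) hN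
    exact hf (ω N) N ((hfg _).trans hP) Ψ hΨ hL hdisc K hK hKN

end Summit.Parity.GeneralizedHardyLittlewood.TwinLowerDensityToGHLShiftLiftTranslationClass
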